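import Summits.CriticalPhenomena.PercolationContinuityZ3.Theorems.PercNearOneGluingNoHeavyQuantGluedWindowHeavyTopIIH
import Summits.CriticalPhenomena.PercolationContinuityZ3.Theorems.PercNearOneGluingNoHeavyQuantGluedWindowHeavyTopL
import HarnessLib

/-!
# QUANT lane R8, T-DEC: LEMMA W's pair condition — ASSEMBLY of the two-row h-mid regime for a pair that is still LIGHT at the glued target: every such
# configuration is one of the four kernel cells lightInc / heavyTopI / heavyTopIIH / heavyTopL — one theorem, no status hypotheses (arm-1 gen 61, architect)

builds on p205010 (kernel theorem, internal audit signed; external expert review pending)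

Support file (`--supports stmt-CriticalPhenomena-4575`), QUANT lane seat prim-quant-arm-1 (gen 61, architect); memo
`run/shared/lean/prim/quant/prim-quant-arm-1-g61/ARCH-G61.md` §3.  Theorems only; standard axioms, no sorries, no definitions.

THE THEOREM **`gluedPullback_windowPair_twoRow_lightPair`**: band frame and price system of `gluedPullback_windowPair_of_lemmaW`; light window pair `(l, h)` below a
cheap atom `c ≥ h`; the two-row regime (`2(l+r) < T ≤ 2(l+r+k)`, `l+r+k ≤ j`) with `h` a mid (`T ≤ 2h`) and the pair still LIGHT at the glued target
(`T − 2l ≤ y(h − l)`) ⟹ `(1−γ)Ψ(l) + γΨ(h) ≤ 0` — NO `GluedLemmaW`, no further hypothesis.  Case split: `2l+r+k ≤ T` → `…_lightInc` (p622867); else branch I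
`qg(2l+r+k−T) ≤ (1−q)(T−2l)` → `…_heavyTopI` (p624653); else the middle copy heavy for the top copy (`yk ≤ T − 2(l+r)`) → `…_heavyTopIIH`, or light →
`…_heavyTopL`.  So family (1′) of the memo (≈ half of the two-row h-mid configurations in the scale-free measure) is ONE kernel theorem; what remains of the h-mid
half is `T − 2l > y(h − l)` (the bottom copy heavy or incompatible into `h`).

HONEST STATUS.  `GluedLemmaW` (flow form), `GluedDominatedMass`, the band, `SiblingStep`, `FarTreeRow` OPEN; RATE class (log\*) / honest sentence of
`run/shared/lean/prim/quant/README.md` unchanged.  [this work].  Nothing here is cited as a published result.  The gluing rows served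
[cite: KozmaNitzan2024, Conjecture 3 (p. 15)]; product measure [cite: Grimmett1999, §1.3 p. 10].
-/

noncomputable section

namespace Summit.CriticalPhenomena.PercolationContinuityZ3.Theorems
namespace Quant
namespace LawDec

/-- **LEMMA W's PAIR CONDITION IN THE TWO-ROW h-MID REGIME FOR A PAIR LIGHT AT THE GLUED TARGET** (`T − 2l ≤ y(h−l)`): no status hypothesis on the copies
w.r.t. the top copy — the four cells `lightInc` / `heavyTopI` / `heavyTopIIH` / `heavyTopL` exhaust the configurations. [this work] -/
theorem gluedPullback_windowPair_twoRow_lightPair (x a q g S : ℝ) (B r k j l h c ls : ℕ) (α p : ℕ → ℝ)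
    (hx0 : 0 < x) (hx1 : x < 1) (ha0 : 0 < a) (ha1 : a ≤ 1) (hq0 : 0 < q) (hq1 : q < 1) (hg0 : 0 ≤ g) (hg1 : g ≤ 1) (hr : 1 ≤ r) (hk : 1 ≤ k)
    (hxqg : x ≤ q * g)
    (hlh : l < h) (hhB : h ≤ B) (hhj : h ≤ j) (hwin : j < h + r + k) (hlow : 2 * (l : ℝ) < a * S) (hcomp : a * S < (l : ℝ) + h)
    (hlight : pairGate (a * x) (a * S) l h < a * x)
    (hL2j : l + r + k ≤ j) (hL2mid : a * (S + q * ((r : ℝ) + k * g)) ≤ 2 * ((l : ℝ) + r + k))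
    (hL1low : 2 * ((l : ℝ) + r) < a * (S + q * ((r : ℝ) + k * g))) (hhmid : a * (S + q * ((r : ℝ) + k * g)) ≤ 2 * (h : ℝ))
    (hlightT : a * (S + q * ((r : ℝ) + k * g)) - 2 * (l : ℝ) ≤ (a * x) * ((h : ℝ) - l))
    (hhc : h ≤ c) (hcB : c ≤ B) (hcj : c ≤ j)
    (hp : ∀ h, 0 ≤ p h)
    (hαp : ∀ l' h', l' ≤ j → 2 * (l' : ℝ) < a * (S + q * ((r : ℝ) + k * g)) → h' ≤ B + (r + k) →
      (j + 1 ≤ h' ∨ a * (S + q * ((r : ℝ) + k * g)) < (l' : ℝ) + h') →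
      α l' ≤ usage (a * x) (a * (S + q * ((r : ℝ) + k * g))) j l' h' * p h')
    (hcheap : -(gluedPullback (a * (S + q * ((r : ℝ) + k * g))) q g j r k α p c) * (a * x)
      < (1 - a * x) * gluedPullback (a * (S + q * ((r : ℝ) + k * g))) q g j r k α p ls) :
    (1 - pairGate (a * x) (a * S) l h) * gluedPullback (a * (S + q * ((r : ℝ) + k * g))) q g j r k α p l
      + pairGate (a * x) (a * S) l h * gluedPullback (a * (S + q * ((r : ℝ) + k * g))) q g j r k α p h ≤ 0 := by
  by_cases hinc : 2 * (l : ℝ) + r + k ≤ a * (S + q * ((r : ℝ) + k * g))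
  · exact gluedPullback_windowPair_twoRow_lightInc x a q g S B r k j l h c ls α p hx0 hx1 ha0 ha1 hq0 hq1 hg0 hg1 hr hk hxqg hlh hhB hhj hwin
      hlow hcomp hlight hL2j hL2mid hL1low hhmid hinc hlightT hhc hcB hcj hp hαp hcheap
  have hAcomp : a * (S + q * ((r : ℝ) + k * g)) < 2 * (l : ℝ) + r + k := lt_of_not_ge hinc
  by_cases hbr : q * g * (2 * (l : ℝ) + r + k - a * (S + q * ((r : ℝ) + k * g))) ≤ (1 - q) * (a * (S + q * ((r : ℝ) + k * g)) - 2 * (l : ℝ))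
  · exact gluedPullback_windowPair_twoRow_heavyTopI x a q g S B r k j l h c ls α p hx0 hx1 ha0 ha1 hq0 hq1 hg0 hg1 hr hk hxqg hlh hhB hhj hwin
      hlow hcomp hlight hL2j hL2mid hL1low hhmid hAcomp hbr hlightT hhc hcB hcj hp hαp hcheap
  have hbrII : (1 - q) * (a * (S + q * ((r : ℝ) + k * g)) - 2 * (l : ℝ)) ≤ q * g * (2 * (l : ℝ) + r + k - a * (S + q * ((r : ℝ) + k * g))) :=
    (lt_of_not_ge hbr).le
  by_cases hB : (a * x) * (k : ℝ) ≤ a * (S + q * ((r : ℝ) + k * g)) - 2 * ((l : ℝ) + r)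
  · exact gluedPullback_windowPair_twoRow_heavyTopIIH x a q g S B r k j l h c ls α p hx0 hx1 ha0 ha1 hq0 hq1 hg0 hg1 hr hk hxqg hlh hhB hhj hwin
      hlow hcomp hlight hL2j hL2mid hL1low hhmid hAcomp hbrII hB hlightT hhc hcB hcj hp hαp hcheap
  · exact gluedPullback_windowPair_twoRow_heavyTopL x a q g S B r k j l h c ls α p hx0 hx1 ha0 ha1 hq0 hq1 hg0 hg1 hr hk hxqg hlh hhB hhj hwin
      hlow hcomp hlight hL2j hL2mid hL1low hhmid hAcomp (lt_of_not_ge hB).le hlightT hhc hcB hcj hp hαp hcheap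

end LawDec
end Quant
end Summit.CriticalPhenomena.PercolationContinuityZ3.Theorems
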